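import Mathlib

/-!
# Passive dressing with a time-dependent injection weight (kernel #226, lemmaR-A5 §28)

Solo-blind programme, session s89.  Companion of `SoloBlindPassiveDressing`: the injection weight
`δ(t) > 0` now varies along the leaf (in the application `δ = A_2(κ g(t))`).  For the skew system
`u' = α u - B w y`, `y' = -λ y + δ(t) w u` the Arnold-weighted energy `E = u² + (B/δ(t)) y²` satisfies
  `(e^{-2A} E)' = -e^{-2A} (B/δ) (2λ + 2α + δ'/δ) y²`      (`A' = α`; bond terms cancel),
so the LEAF HYPOTHESIS `2(λ + α) + δ'/δ ≥ 0` (lemmaR-A5 §28: `-d ln δ/dt ≤ 6K_0 - 2|a|κg`, checked on the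
U16r cusp leaf in kernel #224) makes it non-increasing and gives dressed ≤ bare with constant one.

* `passive_energy_var_hasDerivAt` — the exact derivative;
* `passive_energy_var_antitone` — monotonicity under the leaf hypothesis;
* `passive_dressing_var_bound` — `u(t)² ≤ e^{2(A t - A t')} u(t')²` along the resolvent column.
-/

namespace Summit.AnomalousDissipation.AnomalousDissipation.Theorems

/-- The weighted energy `e^{-2A(t)} (u(t)² + (B/δ(t)) y(t)²)` with time-dependent injection weight. -/
noncomputable def passiveEnergyVar (u y A δ : ℝ → ℝ) (B : ℝ) (t : ℝ) : ℝ :=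
  Real.exp (-2 * A t) * (u t * u t + B * (δ t)⁻¹ * (y t * y t))

/-- EXACT DERIVATIVE with variable `δ`:
`(e^{-2A}(u² + (B/δ)y²))' = -e^{-2A} (B/δ) (2λ + 2α + δ'/δ) y²`. -/
theorem passive_energy_var_hasDerivAt (u y α lam w A δ δ' : ℝ → ℝ) (B : ℝ) (t : ℝ)
    (hδ0 : δ t ≠ 0)
    (hu : HasDerivAt u (α t * u t - B * w t * y t) t)
    (hy : HasDerivAt y (-lam t * y t + δ t * w t * u t) t)
    (hA : HasDerivAt A (α t) t) (hδ : HasDerivAt δ (δ' t) t) :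
    HasDerivAt (passiveEnergyVar u y A δ B)
      (-(Real.exp (-2 * A t) * (B / δ t) * (2 * lam t + 2 * α t + δ' t / δ t) * y t ^ 2)) t := by
  unfold passiveEnergyVar
  have hE : HasDerivAt (fun s => Real.exp (-2 * A s)) (Real.exp (-2 * A t) * (-2 * α t)) t := by
    have h1 : HasDerivAt (fun s => -2 * A s) (-2 * α t) t := hA.const_mul (-2)
    exact h1.exp
  have hu2 := hu.mul hu
  have hw : HasDerivAt (fun s => B * (δ s)⁻¹) (B * (-(δ' t) / δ t ^ 2)) t := (hδ.inv hδ0).const_mul B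
  have hy2 := hw.mul (hy.mul hy)
  have hall := hE.mul (hu2.add hy2)
  refine hall.congr_deriv ?_
  simp only [Pi.mul_apply, Pi.add_apply]
  field_simp
  ring

/-- PASSIVITY under the leaf hypothesis `2(λ + α) + δ'/δ ≥ 0` (`B ≥ 0`, `δ > 0`). -/
theorem passive_energy_var_antitone (u y α lam w A δ δ' : ℝ → ℝ) (B : ℝ) (hB : 0 ≤ B)
    (hδpos : ∀ t, 0 < δ t)
    (hu : ∀ t, HasDerivAt u (α t * u t - B * w t * y t) t)
    (hy : ∀ t, HasDerivAt y (-lam t * y t + δ t * w t * u t) t)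
    (hA : ∀ t, HasDerivAt A (α t) t) (hδ : ∀ t, HasDerivAt δ (δ' t) t)
    (hleaf : ∀ t, 0 ≤ 2 * lam t + 2 * α t + δ' t / δ t) :
    Antitone (passiveEnergyVar u y A δ B) := by
  have hd : ∀ t, HasDerivAt (passiveEnergyVar u y A δ B)
      (-(Real.exp (-2 * A t) * (B / δ t) * (2 * lam t + 2 * α t + δ' t / δ t) * y t ^ 2)) t :=
    fun t => passive_energy_var_hasDerivAt u y α lam w A δ δ' B t (hδpos t).ne' (hu t) (hy t)
      (hA t) (hδ t)
  refine antitone_of_deriv_nonpos (fun t => (hd t).differentiableAt) fun t => ?_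
  rw [(hd t).deriv]
  have h1 : 0 ≤ Real.exp (-2 * A t) := (Real.exp_pos _).le
  have h2 : 0 ≤ B / δ t := div_nonneg hB (hδpos t).le
  have h3 := hleaf t
  have h4 : 0 ≤ y t ^ 2 := sq_nonneg _
  have : 0 ≤ Real.exp (-2 * A t) * (B / δ t) * (2 * lam t + 2 * α t + δ' t / δ t) * y t ^ 2 := by
    positivity
  linarith

/-- DRESSED ≤ BARE with variable injection weight: along the resolvent column (`y(t') = 0`),
`u(t)² ≤ e^{2(A(t) - A(t'))} u(t')²` for all `t ≥ t'` — constant one, no compounding over leaf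
periods, for any fast factor `w(t)`. -/
theorem passive_dressing_var_bound (u y α lam w A δ δ' : ℝ → ℝ) (B : ℝ) (hB : 0 ≤ B)
    (hδpos : ∀ t, 0 < δ t)
    (hu : ∀ t, HasDerivAt u (α t * u t - B * w t * y t) t)
    (hy : ∀ t, HasDerivAt y (-lam t * y t + δ t * w t * u t) t)
    (hA : ∀ t, HasDerivAt A (α t) t) (hδ : ∀ t, HasDerivAt δ (δ' t) t)
    (hleaf : ∀ t, 0 ≤ 2 * lam t + 2 * α t + δ' t / δ t)
    (t' t : ℝ) (htt : t' ≤ t) (hy0 : y t' = 0) :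
    u t ^ 2 ≤ Real.exp (2 * (A t - A t')) * u t' ^ 2 := by
  have hanti := passive_energy_var_antitone u y α lam w A δ δ' B hB hδpos hu hy hA hδ hleaf htt
  unfold passiveEnergyVar at hanti
  rw [hy0, mul_zero, mul_zero, add_zero] at hanti
  have hpos : 0 < Real.exp (-2 * A t) := Real.exp_pos _
  have hyt : 0 ≤ B * (δ t)⁻¹ * (y t * y t) := by
    have := mul_self_nonneg (y t)
    have : 0 ≤ (δ t)⁻¹ := inv_nonneg.mpr (hδpos t).le
    positivity
  have h1 : Real.exp (-2 * A t) * u t ^ 2 ≤ Real.exp (-2 * A t') * u t' ^ 2 := by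
    have : Real.exp (-2 * A t) * (u t * u t)
        ≤ Real.exp (-2 * A t) * (u t * u t + B * (δ t)⁻¹ * (y t * y t)) :=
      mul_le_mul_of_nonneg_left (by linarith) hpos.le
    rw [sq, sq]
    linarith
  have e0 : Real.exp (2 * A t) * (Real.exp (-2 * A t) * u t ^ 2) = u t ^ 2 := by
    rw [← mul_assoc, ← Real.exp_add]; norm_num
  have e1 : Real.exp (2 * A t) * (Real.exp (-2 * A t') * u t' ^ 2)
      = Real.exp (2 * (A t - A t')) * u t' ^ 2 := by
    rw [← mul_assoc, ← Real.exp_add]; ring_nf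
  have h3 := mul_le_mul_of_nonneg_left h1 (Real.exp_pos (2 * A t)).le
  rwa [e0, e1] at h3

end Summit.AnomalousDissipation.AnomalousDissipation.Theorems
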